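import Mathlib
import Literature.NumberTheory.EllipticCurves.KuriharaNumber
import Literature.NumberTheory.EllipticCurves.GaloisAction
import Literature.NumberTheory.EllipticCurves.Tamagawa
import Literature.NumberTheory.EllipticCurves.KatoKolyvaginPrimes
import Literature.NumberTheory.EllipticCurves.ModularCurvePeriodRatio
import Literature.NumberTheory.EllipticCurves.NonEisensteinPrimeOfSurjective
import Literature.NumberTheory.EllipticCurves.LFunctionSmulProofs
import Literature.NumberTheory.EllipticCurves.LeadingTermBSZOrdinaryProofs
import Literature.NumberTheory.EllipticCurves.BSDInvariantsTamagawaProofs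
import Literature.NumberTheory.EllipticCurves.BSDSelmerSmithCasesProofs
import HarnessLib

/-!
# Stub `stub_kuriharaSupply` (line `Sketch` = `kurihara-fourier-support`, crux `PlecticLegs.TwistSupply`)

**Kurihara supply, modulo the printed facts.** Given, as hypotheses, the three printed facts of
`stub_printedFacts` — modularity (`exists_isNewformOf`: every elliptic `W / ℚ` has a newform
`f ∈ S₂(Γ₀(N_W))`), C.-H. Kim 2022, Thm. 1.11 (3) ⇒ (1) clause-free (stated inline: on a globally
minimal model, at a good ordinary prime `p ≥ 5` with `ρ̄_{E,p}` onto, `E(ℚ_p)[p] = 0`,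
`p ∤ ∏ c_v` and the period transfer `Ω(W) = u Ω⁺_f`, `|u|_p = 1`, some Kolyvagin level
`n ∈ 𝒩₁` has a non-zero mod-`p` Kurihara number `δ_n = ∑_{a ∈ (ℤ/n)ˣ} [a/n]⁺ ∏ ψ_q(a)`), and
the period transfer (`realPeriodRat_eq_unit_mul_plusPeriod`) — for EVERY elliptic `W / ℚ` (not
necessarily minimal) and every prime `ℓ ≥ 5` of good ordinary reduction (`ℓ ∤ a_ℓ(W)`, `a_ℓ` read
off `L(W, s)`), with `ρ̄_{W,ℓ}` onto, `W(ℚ_ℓ)[ℓ] = 0` and `ℓ ∤ ∏ c_v`, the newform `f` of `W` at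
level `N = N_{W'}` of a global minimal model `W' = C • W` admits a square-free level `n` prime to
`N` all of whose plus symbols `[a/n]⁺_f` are `ℓ`-integral and whose mod-`ℓ` Kurihara number is
non-zero for some discrete logarithms `ψ`.

Proof (model transport + integrality, all tree theorems):

* pass to a global minimal model `W' = C • W` (`hasGlobalMinimalModel_rat_holds`, Néron /
  Silverman VIII.8.3); the hypotheses are isomorphism invariants: `L(W', s) = L(W, s)`
  (`LFunction_smul`), good reduction (`BSZLemma17.hasGoodReductionAtPrime_smul_iff`), the
  Tamagawa product (`tamagawaProduct_variableChange_holds`), surjectivity of `ρ̄` (the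
  `Γ_ℚ`-equivariant `W[n] ≃+ W'[n]`, `exists_geomTorsion_addEquiv_smul`;
  `kuriharaSupply_hasSurjectiveModNGaloisRep_smul`), and `W(ℚ_ℓ)[ℓ] = 0`
  (`VariableChange.pointEquivBaseChange`; `kuriharaSupply_noPTorsion_smul`); and
  `a_ℓ(W') = L(W)_ℓ` (`LFunction_apply_prime_eq_frobeniusTrace`, Silverman Ex. 8.19(a));
* modularity at `W'` (`NeZero N_{W'}` by `conductorNorm_pos_holds`) gives the newform `f`, which
  is also the newform of `W` (same `L`-coefficients);
* `ρ̄` onto ⇒ `W'[ℓ]` irreducible (`hasIrreducibleModPGaloisRep_of_hasSurjectiveModNGaloisRep`),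
  so the period transfer applies, and then Kim's theorem yields `n ∈ 𝒩₁`, `ψ`, `δ_n ≠ 0`;
* `n` is square-free and prime to `N_{W'}` (`Kato.IsKolyvaginProduct`: every prime `q ∣ n` has
  `q ∤ N_{W'} ℓ`), and the symbols `[a/n]⁺_f` are `ℓ`-integral
  (`IsNewformOf.not_dvd_den_ratPlusSymbol_div`, from irreducibility).
-/

noncomputable section

set_option linter.dupNamespace false

namespace Summit.BirchSwinnertonDyer.BirchSwinnertonDyer.Theorems

open CongruenceSubgroup WeierstrassCurve Literature.NumberTheory.EllipticCurves
  Literature.NumberTheory.EllipticCurves.ModularForms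

open scoped MatrixGroups ModularForm Classical

/-! ### Model transport of the hypotheses -/

/-- **Surjectivity of `ρ̄_{E,n}` does not depend on the Weierstrass model**: for a change of
variables `C` over `ℚ`, if `ρ̄_{W,n} : Γ_ℚ → Aut(W[n])` is onto then so is `ρ̄_{C • W,n}`. The
`Γ_ℚ`-equivariant isomorphism `e : W[n] ≃+ (C • W)[n]` (`exists_geomTorsion_addEquiv_smul`)
conjugates an automorphism `g` of `(C • W)[n]` to `e⁻¹ g e` of `W[n]`, realised by some `σ`;
then `σ` realises `g`. [folklore] -/
theorem kuriharaSupply_hasSurjectiveModNGaloisRep_smul (W : WeierstrassCurve ℚ)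
    (C : VariableChange ℚ) (n : ℤ) (h : W.HasSurjectiveModNGaloisRep n) :
    (C • W).HasSurjectiveModNGaloisRep n := by
  obtain ⟨e, he⟩ := exists_geomTorsion_addEquiv_smul W C n
  intro g
  set g' : geomTorsion (C • W) n ≃+ geomTorsion (C • W) n := Multiplicative.toAdd g with hg'
  obtain ⟨σ, hσ⟩ := h (Multiplicative.ofAdd (e.trans (g'.trans e.symm)))
  have hσP : ∀ P : geomTorsion W n, σ • P = e.symm (g' (e P)) := fun P ↦ by
    rw [← galoisRepTorsion_apply, hσ]
    rfl
  refine ⟨σ, Multiplicative.toAdd.injective (AddEquiv.ext fun Q ↦ ?_)⟩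
  obtain ⟨P, rfl⟩ := e.surjective Q
  rw [galoisRepTorsion_apply, ← he, hσP, AddEquiv.apply_symm_apply]

/-- **`E(ℚ_p)[p] = 0` does not depend on the Weierstrass model**: the substitution
`W(ℚ_p) ≃+ (C • W)(ℚ_p)` (`VariableChange.pointEquivBaseChange`, Silverman III.3.1(b)) is
additive, so it preserves "`p • P = 0 ⇒ P = 0`". [folklore] -/
theorem kuriharaSupply_noPTorsion_smul (W : WeierstrassCurve ℚ) (C : VariableChange ℚ) (p : ℕ)
    [Fact p.Prime] (h : ∀ P : (W.baseChange ℚ_[p]).toAffine.Point, (p : ℤ) • P = 0 → P = 0)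
    (P : ((C • W).baseChange ℚ_[p]).toAffine.Point) (hP : (p : ℤ) • P = 0) : P = 0 := by
  set e := VariableChange.pointEquivBaseChange W C ℚ_[p] with he
  have h1 : (p : ℤ) • e.symm P = 0 := by rw [← map_zsmul, hP, map_zero]
  rw [← e.apply_symm_apply P, h _ h1, map_zero]

/-! ### The supply -/

/-- **Kurihara supply, modulo the printed facts** (stub `stub_kuriharaSupply` of line `Sketch`):
GIVEN modularity (`exists_isNewformOf`), Kim 2022 Thm. 1.11 (3) ⇒ (1) clause-free (inline) and
the period transfer (`realPeriodRat_eq_unit_mul_plusPeriod`) as hypotheses, for every elliptic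
`W / ℚ` and every prime `ℓ ≥ 5` of good ordinary reduction with `ρ̄_{W,ℓ}` onto, `W(ℚ_ℓ)[ℓ] = 0`
and `ℓ ∤ ∏ c_v`, there are a level `N` (the conductor of a global minimal model), the newform
`f ∈ S₂(Γ₀(N))` of `W`, a square-free `n` prime to `N` with `ℓ`-integral plus symbols
`[a/n]⁺_f`, `a ∈ (ℤ/n)ˣ`, and discrete logarithms `ψ` with `kuriharaNumber f ℓ n ψ ≠ 0`.
Proof: model transport to `C • W` (`hasGlobalMinimalModel_rat_holds`, `LFunction_smul`,
`BSZLemma17.hasGoodReductionAtPrime_smul_iff`, `tamagawaProduct_variableChange_holds`,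
`kuriharaSupply_hasSurjectiveModNGaloisRep_smul`, `kuriharaSupply_noPTorsion_smul`,
`LFunction_apply_prime_eq_frobeniusTrace`), modularity, surjective ⇒ irreducible
(`hasIrreducibleModPGaloisRep_of_hasSurjectiveModNGaloisRep`), period transfer, Kim; then
`Kato.IsKolyvaginProduct` gives square-freeness and coprimality to `N`, and
`IsNewformOf.not_dvd_den_ratPlusSymbol_div` the integrality. [folklore] -/
theorem stub_kuriharaSupply :
    exists_isNewformOf →
    (∀ (W : WeierstrassCurve ℚ) [W.IsElliptic] [W.IsGloballyMinimal] (p : ℕ) [Fact p.Prime],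
      5 ≤ p → W.HasGoodReductionAtPrime p → ¬ (p : ℤ) ∣ W.frobeniusTrace p →
      W.HasSurjectiveModNGaloisRep p →
      (∀ P : (W.baseChange ℚ_[p]).toAffine.Point, (p : ℤ) • P = 0 → P = 0) →
      ¬ p ∣ W.tamagawaProduct →
      ∀ {N : ℕ} [NeZero N] (f : CuspForm (Gamma0 N) 2), IsNewformOf W f →
      (∃ u : ℚ, ‖(u : ℚ_[p])‖ = 1 ∧ W.realPeriodRat = u * plusPeriod f) →
      ∃ (n : ℕ) (_ : NeZero n), Kato.IsKolyvaginProduct W p 1 n ∧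
        ∃ ψ : (ℓ : ℕ) → (ZMod ℓ)ˣ →* Multiplicative (ZMod p),
          (∀ ℓ ∈ n.primeFactors, Function.Surjective (ψ ℓ)) ∧ kuriharaNumber f p n ψ ≠ 0) →
    realPeriodRat_eq_unit_mul_plusPeriod →
    ∀ (W : WeierstrassCurve ℚ) [W.IsElliptic] (ℓ : ℕ) [Fact ℓ.Prime],
      5 ≤ ℓ → W.HasGoodReductionAtPrime ℓ → ¬ (ℓ : ℤ) ∣ W.LFunction ℓ →
      W.HasSurjectiveModNGaloisRep (ℓ : ℤ) →
      (∀ P : (W.baseChange ℚ_[ℓ]).toAffine.Point, (ℓ : ℤ) • P = 0 → P = 0) →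
      ¬ ℓ ∣ W.tamagawaProduct →
      ∃ (N : ℕ) (_ : NeZero N) (f : CuspForm (Gamma0 N) 2), IsNewformOf W f ∧
        ∃ (n : ℕ) (_ : NeZero n), Squarefree n ∧ n.Coprime N ∧
          (∀ a : (ZMod n)ˣ, ¬ ℓ ∣ (ratPlusSymbol f (((a : ZMod n).val : ℚ) / n)).den) ∧
          ∃ ψ : (q : ℕ) → (ZMod q)ˣ →* Multiplicative (ZMod ℓ), kuriharaNumber f ℓ n ψ ≠ 0 := by
  intro hmod hKim hper W _ ℓ _ h5 hgood hord hsurj htors htam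
  -- Step 1: a global minimal model `C • W` (Néron; Silverman VIII.8.3).
  obtain ⟨C, hC⟩ := hasGlobalMinimalModel_rat_holds W
  haveI : (C • W).IsGloballyMinimal := hC
  -- Step 2: the hypotheses are isomorphism invariants.
  have hL : (C • W).LFunction = W.LFunction := LFunction_smul W C
  have hgood' : (C • W).HasGoodReductionAtPrime ℓ :=
    (BSZLemma17.hasGoodReductionAtPrime_smul_iff W C ℓ).mpr hgood
  have hord' : ¬ (ℓ : ℤ) ∣ (C • W).frobeniusTrace ℓ := by
    rw [← LFunction_apply_prime_eq_frobeniusTrace (C • W) ℓ hgood', hL]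
    exact hord
  have hsurj' : (C • W).HasSurjectiveModNGaloisRep (ℓ : ℤ) :=
    kuriharaSupply_hasSurjectiveModNGaloisRep_smul W C ℓ hsurj
  have htors' : ∀ P : ((C • W).baseChange ℚ_[ℓ]).toAffine.Point, (ℓ : ℤ) • P = 0 → P = 0 :=
    kuriharaSupply_noPTorsion_smul W C ℓ htors
  have htam' : ¬ ℓ ∣ (C • W).tamagawaProduct := by
    rw [tamagawaProduct_variableChange_holds W C]
    exact htam
  -- Step 3: modularity at the minimal model; `f` is also the newform of `W`.
  haveI hN : NeZero ((C • W).conductorNorm ℤ) := ⟨((C • W).conductorNorm_pos_holds).ne'⟩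
  obtain ⟨f, hf'⟩ := hmod (C • W)
  have hfW : IsNewformOf W f := ⟨hf'.1, fun m ↦ by rw [hf'.2 m, hL]⟩
  -- Step 4: surjective ⇒ irreducible; period transfer; Kim.
  haveI : NeZero (ℓ : ℚ) := ⟨Nat.cast_ne_zero.mpr (Fact.out : ℓ.Prime).ne_zero⟩
  have hirr : (C • W).HasIrreducibleModPGaloisRep ℓ :=
    hasIrreducibleModPGaloisRep_of_hasSurjectiveModNGaloisRep (C • W) ℓ hsurj'
  have hu : ∃ u : ℚ, ‖(u : ℚ_[ℓ])‖ = 1 ∧ (C • W).realPeriodRat = u * plusPeriod f :=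
    hper (C • W) ℓ h5 hgood' hirr f hf'
  obtain ⟨n, hn0, hkoly, ψ, -, hδ⟩ := hKim (C • W) ℓ h5 hgood' hord' hsurj' htors' htam' f hf' hu
  -- Step 5: `n` is square-free and prime to the level; the symbols are `ℓ`-integral.
  have hcop : n.Coprime ((C • W).conductorNorm ℤ) := Nat.coprime_of_dvd fun k hk hkn hkN ↦
    (hkoly.2 k (Nat.mem_primeFactors.mpr ⟨hk, hkn, hkoly.1.ne_zero⟩)).not_dvd_conductorNorm hkN
  have hℓ2 : ℓ ≠ 2 := by omega
  have hint : ∀ a : (ZMod n)ˣ, ¬ ℓ ∣ (ratPlusSymbol f (((a : ZMod n).val : ℚ) / n)).den := by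
    intro a
    simpa only [Int.cast_natCast] using
      hf'.not_dvd_den_ratPlusSymbol_div hℓ2 hirr hcop (((a : ZMod n).val : ℕ) : ℤ)
  exact ⟨(C • W).conductorNorm ℤ, hN, f, hfW, n, hn0, hkoly.1, hcop, hint, ψ, hδ⟩

end Summit.BirchSwinnertonDyer.BirchSwinnertonDyer.Theorems

end
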